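import Mathlib.Analysis.Calculus.ParametricIntegral
import Mathlib.Analysis.SpecialFunctions.ExpDeriv
import Literature.NumberTheory.Automorphic.AdeleQuotientFourierInversion
import Literature.NumberTheory.Automorphic.AdelicGLnGlue
import HarnessLib

/-!
# Decay of the Fourier coefficients of differentiable functions on `𝔸_K ⧸ K`
(the integration by parts of Moeglin–Waldspurger (1995), proof of Lemma I.2.10, and of the
Fourier–Whittaker expansion of smooth cusp forms, Cogdell (2004), §1.1)

Topic `NumberTheory/Automorphic`; sequel to `AdeleQuotientFourierInversion` (pointwise Fourier
inversion on `𝔸_K ⧸ K` for continuous functions with absolutely summable coefficients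
`f̂(ξ) = ∫ conj ψ_ξ · f`, `ψ_ξ = adeleQuotChar K ξ`). The absolute summability is supplied, for
functions smooth in the archimedean variable, by integration by parts along the archimedean lines
`s ↦ (s v, 0) + K` of `𝔸_K ⧸ K` (`v ∈ K_∞ ≅ mixedSpace K = ℝ^{r₁} × ℂ^{r₂}`). This file PROVES the
one-step and the iterated form of that integration by parts:

* `coe_adeleQuotChar_mk_infiniteAdeleInl` — **the characters on the archimedean part**:
  `ψ_ξ((y, 0) + K) = exp(-2πi · Tr(ξ · y))` with `Tr = mixedTrace K` the trace form of `K_∞`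
  (`AdelicAdditiveCharacterDuality`) and `ξ` embedded by `mixedEmbedding K`; in particular along
  the line of direction `v`, `ψ_ξ((s v, 0) + K) = exp(-2πi s · Tr(ξ v))`
  (`coe_adeleQuotChar_archLine`).
* `integral_conj_adeleQuotChar_mul_of_hasDerivAt` — **the coefficient of a derivative**: if `f, f₁`
  are continuous on `𝔸_K ⧸ K` and `s ↦ f(u + (s v, 0))` has derivative `f₁(u + (s v, 0))`
  everywhere, then `f̂₁(ξ) = -2πi Tr(ξ v) · f̂(ξ)` (differentiate the translation covariance
  `∫ conj ψ_ξ(u) f(u + w_s) du = ψ_ξ(w_s) f̂(ξ)` of `AdeleQuotientFourierInversion` at `s = 0`, under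
  the integral sign on the left — dominated convergence on the compact group, `f₁` being bounded).
* `norm_integral_conj_adeleQuotChar_mul_mul_pow_eq` — **iterated**: for a chain
  `f = f₀, f₁, …, f_k` of continuous functions, each the derivative of the previous one along `v`,
  `‖f̂(ξ)‖ · (2π |Tr(ξ v)|)^k = ‖f̂_k(ξ)‖ ≤ sup ‖f_k‖`
  (`norm_integral_conj_adeleQuotChar_mul_mul_pow_le`).
* `norm_le_sum_abs_mixedTrace_mul` — **the trace form sees the sup norm**: for `x ∈ mixedSpace K`,
  `‖x‖ ≤ ∑_{w real} |Tr(x 1_w)| + ∑_{w complex} (|Tr(x 1_w)| + |Tr(x i_w)|)` for the coordinate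
  vectors `1_w` (`w` real) and `1_w, i_w` (`w` complex).

Everything here is proved; [folklore] real/harmonic analysis (the role in MW I.2.10 and in
Cogdell's Thm. 1.1 is the reason for the location of the file).

## References

* C. Moeglin, J.-L. Waldspurger, *Spectral decomposition and Eisenstein series*, Cambridge Tracts
  in Math. 113 (1995), proof of Lemma I.2.10 ("via integration by parts") [MoeglinWaldspurger1995].
* J. W. Cogdell, *Analytic theory of L-functions for GL_n*, in: J. Bernstein, S. Gelbart (eds.),
  *An Introduction to the Langlands Program* (2004), §1.1 [CogdellAnalyticTheory2004].
-/

noncomputable section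

open _root_.MeasureTheory _root_.MeasureTheory.Measure Set Filter IsDedekindDomain NumberField
open NumberField.mixedEmbedding NumberField.InfinitePlace
open _root_.Topology
open scoped ENNReal ComplexConjugate Real

namespace Literature.NumberTheory.Automorphic

/-! ### The characters `ψ_ξ` on the archimedean part of `𝔸_K ⧸ K` -/

section ArchLine

variable (K : Type) [Field K] [NumberField K]

/-- An adele with vanishing finite part (`infiniteAdeleInl K y = (y, 0)`) is finite-integral.
[folklore] -/
theorem isFiniteIntegral_infiniteAdeleInl (y : InfiniteAdeleRing K) :
    IsFiniteIntegral K (infiniteAdeleInl K y) :=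
  fun v => isFiniteIntegral_zero K v

/-- `ξ · (y, 0) = (ξ y, 0)` in `𝔸_K = K_∞ × 𝔸_K^∞`. [folklore] -/
theorem algebraMap_mul_infiniteAdeleInl (ξ : K) (y : InfiniteAdeleRing K) :
    algebraMap K (AdeleRing (𝓞 K) K) ξ * infiniteAdeleInl K y =
      infiniteAdeleInl K (algebraMap K (InfiniteAdeleRing K) ξ * y) :=
  Prod.ext rfl (show (algebraMap K (AdeleRing (𝓞 K) K) ξ).2 * (0 : FiniteAdeleRing (𝓞 K) K) = 0
    from mul_zero _)

/-- **The characters `ψ_ξ` on the archimedean part of `𝔸_K ⧸ K`**: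
`ψ_ξ((y, 0) + K) = exp(-2πi · Tr(ξ y))`, `Tr = mixedTrace K` the trace form `K_∞ → ℝ` read on
`mixedSpace K` and `ξ ↦ mixedEmbedding K ξ` (`ψ_K(x) = exp(-2πi Tr_{K_∞/ℝ}(x_∞))` on finite-integral
adeles, `adeleAddChar_apply_of_isFiniteIntegral`). [folklore] -/
theorem coe_adeleQuotChar_mk_infiniteAdeleInl (ξ : K) (y : InfiniteAdeleRing K) :
    (adeleQuotChar K ξ (QuotientAddGroup.mk (infiniteAdeleInl K y)) : ℂ) =
      Complex.exp (((-(2 * π * mixedTrace K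
        (mixedEmbedding K ξ * InfiniteAdeleRing.ringEquiv_mixedSpace K y)) : ℝ) : ℂ) * Complex.I) := by
  rw [adeleQuotChar_mk, algebraMap_mul_infiniteAdeleInl,
    adeleAddChar_apply_of_isFiniteIntegral K (isFiniteIntegral_infiniteAdeleInl K _)]
  change ((AddCircle.toCircle (-((infiniteAdeleTrace K
    (algebraMap K (InfiniteAdeleRing K) ξ * y) : ℝ) : AddCircle (1 : ℝ))) : Circle) : ℂ) = _
  rw [← AddCircle.coe_neg, AddCircle.toCircle_apply_mk, Circle.coe_exp, div_one,
    ← mixedTrace_ringEquiv_mixedSpace, map_mul, ← InfiniteAdeleRing.mixedEmbedding_eq_algebraMap_comp]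
  congr 1
  push_cast
  ring

/-- **`ψ_ξ` along the archimedean line of direction `v`**: for `v ∈ mixedSpace K ≅ K_∞` and
`s ∈ ℝ`, `ψ_ξ((s v, 0) + K) = exp(-2πi s · Tr(ξ v))`. [folklore] -/
theorem coe_adeleQuotChar_archLine (ξ : K) (v : mixedSpace K) (s : ℝ) :
    (adeleQuotChar K ξ (QuotientAddGroup.mk
      (infiniteAdeleInl K ((InfiniteAdeleRing.ringEquiv_mixedSpace K).symm (s • v)))) : ℂ) =
      Complex.exp ((((-(2 * π * mixedTrace K (mixedEmbedding K ξ * v))) : ℝ) : ℂ) * (s : ℂ) *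
        Complex.I) := by
  rw [coe_adeleQuotChar_mk_infiniteAdeleInl, RingEquiv.apply_symm_apply, mul_smul_comm, map_smul,
    smul_eq_mul]
  congr 1
  push_cast
  ring

/-- The archimedean line is additive in the parameter: `(s v, 0) + (t v, 0) = ((s + t) v, 0)` in
`𝔸_K ⧸ K`. [folklore] -/
theorem archLine_add (v : mixedSpace K) (s t : ℝ) :
    (QuotientAddGroup.mk (infiniteAdeleInl K ((InfiniteAdeleRing.ringEquiv_mixedSpace K).symm (s • v))) : adeleQuotient K) +
      QuotientAddGroup.mk (infiniteAdeleInl K ((InfiniteAdeleRing.ringEquiv_mixedSpace K).symm (t • v))) =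
      QuotientAddGroup.mk (infiniteAdeleInl K ((InfiniteAdeleRing.ringEquiv_mixedSpace K).symm ((s + t) • v))) := by
  rw [← QuotientAddGroup.mk_add, ← map_add, ← map_add, ← add_smul]

/-- The archimedean line passes through the origin at `s = 0`. [folklore] -/
theorem archLine_zero (v : mixedSpace K) :
    (QuotientAddGroup.mk (infiniteAdeleInl K ((InfiniteAdeleRing.ringEquiv_mixedSpace K).symm ((0 : ℝ) • v))) : adeleQuotient K) = 0 := by
  rw [zero_smul, map_zero, map_zero, QuotientAddGroup.mk_zero]

end ArchLine

/-! ### The Fourier coefficient of a derivative -/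

section Derivative

variable (K : Type) [Field K] [NumberField K]
  [MeasurableSpace (adeleQuotient K)] [BorelSpace (adeleQuotient K)]

omit [MeasurableSpace (adeleQuotient K)] [BorelSpace (adeleQuotient K)] in
/-- A continuous function on the compact group `𝔸_K ⧸ K` is bounded. [folklore] -/
theorem exists_forall_norm_le_of_continuous {f : adeleQuotient K → ℂ} (hf : Continuous f) :
    ∃ M : ℝ, 0 ≤ M ∧ ∀ u, ‖f u‖ ≤ M := by
  obtain ⟨C, hC⟩ := isCompact_univ.exists_bound_of_continuousOn (hf.continuousOn (s := univ))
  exact ⟨max C 0, le_max_right _ _, fun u => (hC u (mem_univ u)).trans (le_max_left _ _)⟩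

/-- The norm of a Fourier coefficient is at most the sup norm: `‖f̂(ξ)‖ ≤ M` if `‖f‖ ≤ M`
(`|ψ_ξ| = 1`, probability measure). [folklore] -/
theorem norm_integral_conj_adeleQuotChar_mul_le {f : adeleQuotient K → ℂ} {M : ℝ}
    (hM : ∀ u, ‖f u‖ ≤ M) (ξ : K) :
    ‖∫ u, conj (adeleQuotChar K ξ u : ℂ) * f u ∂(adeleQuotHaar K)‖ ≤ M := by
  have h1 : ∀ u, ‖conj (adeleQuotChar K ξ u : ℂ) * f u‖ ≤ M := fun u => by
    rw [norm_mul, Complex.norm_conj, norm_adeleQuotChar, one_mul]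
    exact hM u
  calc ‖∫ u, conj (adeleQuotChar K ξ u : ℂ) * f u ∂(adeleQuotHaar K)‖
      ≤ ∫ _, M ∂(adeleQuotHaar K) := norm_integral_le_of_norm_le (integrable_const M)
          (Eventually.of_forall h1)
    _ = M := by simp

/-- **The Fourier coefficient of a derivative along an archimedean line.** Let `f, f₁` be
continuous on `𝔸_K ⧸ K`, `v ∈ K_∞ ≅ mixedSpace K`, and suppose that for every `u` and `s` the
function `s ↦ f(u + (s v, 0))` has derivative `f₁(u + (s v, 0))` at `s`. Then
`f̂₁(ξ) = -2πi Tr(ξ v) · f̂(ξ)`: the translation covariance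
`∫ conj ψ_ξ(u) f(u + (s v, 0)) du = ψ_ξ((s v, 0)) f̂(ξ) = e^{-2πi s Tr(ξ v)} f̂(ξ)`
(`integral_conj_adeleQuotChar_mul_comp_add`) differentiated at `s = 0`, under the integral sign on
the left (dominated convergence, `f₁` bounded on the compact group). This is the integration by
parts of Moeglin–Waldspurger's proof of Lemma I.2.10. [cite: MoeglinWaldspurger1995, proof of Lemma I.2.10] -/
theorem integral_conj_adeleQuotChar_mul_of_hasDerivAt {f f₁ : adeleQuotient K → ℂ}
    (hf : Continuous f) (hf₁ : Continuous f₁) (v : mixedSpace K)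
    (hder : ∀ (u : adeleQuotient K) (s : ℝ), HasDerivAt
      (fun s : ℝ => f (u + QuotientAddGroup.mk
        (infiniteAdeleInl K ((InfiniteAdeleRing.ringEquiv_mixedSpace K).symm (s • v)))))
      (f₁ (u + QuotientAddGroup.mk
        (infiniteAdeleInl K ((InfiniteAdeleRing.ringEquiv_mixedSpace K).symm (s • v))))) s)
    (ξ : K) :
    ∫ u, conj (adeleQuotChar K ξ u : ℂ) * f₁ u ∂(adeleQuotHaar K) =
      ((((-(2 * π * mixedTrace K (mixedEmbedding K ξ * v))) : ℝ) : ℂ) * Complex.I) *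
        ∫ u, conj (adeleQuotChar K ξ u : ℂ) * f u ∂(adeleQuotHaar K) := by
  -- the line and the constant
  set w : ℝ → adeleQuotient K := fun s => QuotientAddGroup.mk
    (infiniteAdeleInl K ((InfiniteAdeleRing.ringEquiv_mixedSpace K).symm (s • v))) with hw
  set c : ℂ := (((-(2 * π * mixedTrace K (mixedEmbedding K ξ * v))) : ℝ) : ℂ) * Complex.I with hc
  set A : ℂ := ∫ u, conj (adeleQuotChar K ξ u : ℂ) * f u ∂(adeleQuotHaar K) with hA
  -- the parametric integrand and its derivative
  set F : ℝ → adeleQuotient K → ℂ := fun s u => conj (adeleQuotChar K ξ u : ℂ) * f (u + w s)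
    with hF
  set F' : ℝ → adeleQuotient K → ℂ := fun s u => conj (adeleQuotChar K ξ u : ℂ) * f₁ (u + w s)
    with hF'
  have hconj : Continuous fun u : adeleQuotient K => conj (adeleQuotChar K ξ u : ℂ) :=
    Complex.continuous_conj.comp (continuous_adeleQuotChar K ξ)
  have hFc : ∀ s, Continuous (F s) := fun s =>
    hconj.mul (hf.comp (continuous_id.add continuous_const))
  have hF'c : ∀ s, Continuous (F' s) := fun s =>
    hconj.mul (hf₁.comp (continuous_id.add continuous_const))
  obtain ⟨M, -, hM⟩ := exists_forall_norm_le_of_continuous K hf₁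
  have hbound : ∀ (u : adeleQuotient K) (s : ℝ), ‖F' s u‖ ≤ M := fun u s => by
    simp only [hF']
    rw [norm_mul, Complex.norm_conj, norm_adeleQuotChar, one_mul]
    exact hM _
  have hdiff : ∀ (u : adeleQuotient K) (s : ℝ), HasDerivAt (fun s => F s u) (F' s u) s :=
    fun u s => by
    simp only [hF, hF']
    exact (hder u s).const_mul _
  -- differentiate under the integral sign at `s = 0`
  have key := hasDerivAt_integral_of_dominated_loc_of_deriv_le (μ := adeleQuotHaar K)
    (x₀ := (0 : ℝ)) (F := F) (F' := F') (s := univ) (bound := fun _ => M) univ_mem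
    (Eventually.of_forall fun s => (hFc s).aestronglyMeasurable)
    ((hFc 0).integrable_of_hasCompactSupport (HasCompactSupport.of_compactSpace _))
    (hF'c 0).aestronglyMeasurable
    (Eventually.of_forall fun u s _ => hbound u s) (integrable_const M)
    (Eventually.of_forall fun u s _ => hdiff u s)
  obtain ⟨-, hderiv⟩ := key
  -- the same function computed by translation covariance: `s ↦ exp(c s) • A`
  have hcov : (fun s : ℝ => ∫ u, F s u ∂(adeleQuotHaar K)) =
      fun s : ℝ => Complex.exp (c * (s : ℂ)) * A := by
    funext s
    simp only [hF]
    rw [integral_conj_adeleQuotChar_mul_comp_add K f ξ (w s)]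
    simp only [hw]
    rw [coe_adeleQuotChar_archLine, hc]
    congr 1
    ring
  have hexp : HasDerivAt (fun s : ℝ => Complex.exp (c * (s : ℂ)) * A) (c * A) 0 := by
    have h1 : HasDerivAt (fun z : ℂ => Complex.exp (c * z)) (Complex.exp (c * (0 : ℝ)) * (c * 1))
        ((0 : ℝ) : ℂ) := ((hasDerivAt_id' ((0 : ℝ) : ℂ)).const_mul c).cexp
    have h2 := h1.comp_ofReal.mul_const A
    simp only [Complex.ofReal_zero, mul_zero, Complex.exp_zero, one_mul, mul_one] at h2
    exact h2
  rw [hcov] at hderiv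
  have hval : ∫ u, F' 0 u ∂(adeleQuotHaar K) = c * A := hderiv.unique hexp
  simp only [hF', hw, archLine_zero, add_zero] at hval
  exact hval

/-- **Iterated integration by parts along an archimedean line.** For a chain `f 0, f 1, …, f k` of
continuous functions on `𝔸_K ⧸ K`, each the derivative of the previous one along the line of
direction `v`, the Fourier coefficients satisfy `‖f̂₀(ξ)‖ · (2π |Tr(ξ v)|)^k = ‖f̂_k(ξ)‖`.
[cite: MoeglinWaldspurger1995, proof of Lemma I.2.10] -/
theorem norm_integral_conj_adeleQuotChar_mul_mul_pow_eq (f : ℕ → adeleQuotient K → ℂ) (k : ℕ)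
    (hf : ∀ j ≤ k, Continuous (f j)) (v : mixedSpace K)
    (hder : ∀ j < k, ∀ (u : adeleQuotient K) (s : ℝ), HasDerivAt
      (fun s : ℝ => f j (u + QuotientAddGroup.mk
        (infiniteAdeleInl K ((InfiniteAdeleRing.ringEquiv_mixedSpace K).symm (s • v)))))
      (f (j + 1) (u + QuotientAddGroup.mk
        (infiniteAdeleInl K ((InfiniteAdeleRing.ringEquiv_mixedSpace K).symm (s • v))))) s)
    (ξ : K) :
    ‖∫ u, conj (adeleQuotChar K ξ u : ℂ) * f 0 u ∂(adeleQuotHaar K)‖ *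
        (2 * π * |mixedTrace K (mixedEmbedding K ξ * v)|) ^ k =
      ‖∫ u, conj (adeleQuotChar K ξ u : ℂ) * f k u ∂(adeleQuotHaar K)‖ := by
  induction k with
  | zero => rw [pow_zero, mul_one]
  | succ k ih =>
    have hstep := integral_conj_adeleQuotChar_mul_of_hasDerivAt K (hf k (Nat.le_succ k))
      (hf (k + 1) le_rfl) v (hder k (Nat.lt_succ_self k)) ξ
    rw [hstep, norm_mul, ← ih (fun j hj => hf j (hj.trans (Nat.le_succ k)))
      (fun j hj => hder j (hj.trans (Nat.lt_succ_self k))), pow_succ]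
    have hnc : ‖((((-(2 * π * mixedTrace K (mixedEmbedding K ξ * v))) : ℝ) : ℂ) * Complex.I)‖ =
        2 * π * |mixedTrace K (mixedEmbedding K ξ * v)| := by
      rw [norm_mul, Complex.norm_I, mul_one, Complex.norm_real, Real.norm_eq_abs, abs_neg,
        abs_mul, abs_of_pos Real.two_pi_pos]
    rw [hnc]
    ring

/-- **Decay of the Fourier coefficients from a derivative chain**: with the notation of
`norm_integral_conj_adeleQuotChar_mul_mul_pow_eq`, if `‖f_k‖ ≤ M` then
`‖f̂₀(ξ)‖ · (2π |Tr(ξ v)|)^k ≤ M`. [cite: MoeglinWaldspurger1995, proof of Lemma I.2.10] -/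
theorem norm_integral_conj_adeleQuotChar_mul_mul_pow_le (f : ℕ → adeleQuotient K → ℂ) (k : ℕ)
    (hf : ∀ j ≤ k, Continuous (f j)) (v : mixedSpace K)
    (hder : ∀ j < k, ∀ (u : adeleQuotient K) (s : ℝ), HasDerivAt
      (fun s : ℝ => f j (u + QuotientAddGroup.mk
        (infiniteAdeleInl K ((InfiniteAdeleRing.ringEquiv_mixedSpace K).symm (s • v)))))
      (f (j + 1) (u + QuotientAddGroup.mk
        (infiniteAdeleInl K ((InfiniteAdeleRing.ringEquiv_mixedSpace K).symm (s • v))))) s)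
    {M : ℝ} (hM : ∀ u, ‖f k u‖ ≤ M) (ξ : K) :
    ‖∫ u, conj (adeleQuotChar K ξ u : ℂ) * f 0 u ∂(adeleQuotHaar K)‖ *
        (2 * π * |mixedTrace K (mixedEmbedding K ξ * v)|) ^ k ≤ M := by
  rw [norm_integral_conj_adeleQuotChar_mul_mul_pow_eq K f k hf v hder ξ]
  exact norm_integral_conj_adeleQuotChar_mul_le K hM ξ

end Derivative

/-! ### The trace form sees the sup norm of `mixedSpace K` -/

section Directions

variable (K : Type) [Field K] [NumberField K]

open scoped Classical in
/-- `Tr(x · (1_w, 0)) = x_w` for a real place `w` (`Tr = mixedTrace K`). [folklore] -/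
theorem mixedTrace_mul_single_real (x : mixedSpace K) (w : {w : InfinitePlace K // w.IsReal}) :
    mixedTrace K (x * ((Pi.single w 1, 0) : mixedSpace K)) = x.1 w := by
  simp [mixedTrace_apply, Pi.single_apply]

open scoped Classical in
/-- `Tr(x · (0, c 1_w)) = 2 Re(x_w c)` for a complex place `w` and `c ∈ ℂ`. [folklore] -/
theorem mixedTrace_mul_single_complex (x : mixedSpace K)
    (w : {w : InfinitePlace K // w.IsComplex}) (c : ℂ) :
    mixedTrace K (x * ((0, Pi.single w c) : mixedSpace K)) = 2 * (x.2 w * c).re := by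
  simp [mixedTrace_apply, Pi.single_apply, apply_ite Complex.re]

open scoped Classical in
/-- **The coordinates of `mixedSpace K` are traces**: for `x ∈ ℝ^{r₁} × ℂ^{r₂}` the sup norm is
bounded by the trace functionals against the coordinate directions,
`‖x‖ ≤ ∑_{w real} |Tr(x (1_w, 0))| + ∑_{w complex} (|Tr(x (0, 1_w))| + |Tr(x (0, i_w))|)`
(`Tr(x (1_w,0)) = x_w`, `Tr(x (0,1_w)) = 2 Re x_w`, `Tr(x (0, i_w)) = -2 Im x_w`, and
`|z| ≤ |Re z| + |Im z|`). [folklore] -/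
theorem norm_le_sum_abs_mixedTrace_mul (x : mixedSpace K) :
    ‖x‖ ≤ (∑ w : {w : InfinitePlace K // w.IsReal},
        |mixedTrace K (x * ((Pi.single w 1, 0) : mixedSpace K))|) +
      ∑ w : {w : InfinitePlace K // w.IsComplex},
        (|mixedTrace K (x * ((0, Pi.single w 1) : mixedSpace K))| +
          |mixedTrace K (x * ((0, Pi.single w Complex.I) : mixedSpace K))|) := by
  set S₁ := ∑ w : {w : InfinitePlace K // w.IsReal},
    |mixedTrace K (x * ((Pi.single w 1, 0) : mixedSpace K))| with hS₁
  set S₂ := ∑ w : {w : InfinitePlace K // w.IsComplex},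
    (|mixedTrace K (x * ((0, Pi.single w 1) : mixedSpace K))| +
      |mixedTrace K (x * ((0, Pi.single w Complex.I) : mixedSpace K))|) with hS₂
  have hS₁0 : 0 ≤ S₁ := Finset.sum_nonneg fun w _ => abs_nonneg _
  have hS₂0 : 0 ≤ S₂ := Finset.sum_nonneg fun w _ => add_nonneg (abs_nonneg _) (abs_nonneg _)
  have h1 : ‖x.1‖ ≤ S₁ := by
    refine (pi_norm_le_iff_of_nonneg hS₁0).2 fun w => ?_
    rw [Real.norm_eq_abs, ← mixedTrace_mul_single_real K x w]
    exact Finset.single_le_sum (f := fun w : {w : InfinitePlace K // w.IsReal} =>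
      |mixedTrace K (x * ((Pi.single w 1, 0) : mixedSpace K))|) (fun w _ => abs_nonneg _)
      (Finset.mem_univ w)
  have h2 : ‖x.2‖ ≤ S₂ := by
    refine (pi_norm_le_iff_of_nonneg hS₂0).2 fun w => ?_
    have hre : |(x.2 w).re| ≤ |mixedTrace K (x * ((0, Pi.single w 1) : mixedSpace K))| := by
      rw [mixedTrace_mul_single_complex, mul_one, abs_mul, abs_two]
      linarith [abs_nonneg (x.2 w).re]
    have him : |(x.2 w).im| ≤ |mixedTrace K (x * ((0, Pi.single w Complex.I) : mixedSpace K))| := by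
      rw [mixedTrace_mul_single_complex, Complex.mul_I_re, mul_neg, abs_neg, abs_mul, abs_two]
      linarith [abs_nonneg (x.2 w).im]
    calc ‖x.2 w‖ ≤ |(x.2 w).re| + |(x.2 w).im| := Complex.norm_le_abs_re_add_abs_im _
      _ ≤ |mixedTrace K (x * ((0, Pi.single w 1) : mixedSpace K))| +
          |mixedTrace K (x * ((0, Pi.single w Complex.I) : mixedSpace K))| := add_le_add hre him
      _ ≤ S₂ := Finset.single_le_sum (f := fun w : {w : InfinitePlace K // w.IsComplex} =>
          |mixedTrace K (x * ((0, Pi.single w 1) : mixedSpace K))| +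
            |mixedTrace K (x * ((0, Pi.single w Complex.I) : mixedSpace K))|)
          (fun w _ => add_nonneg (abs_nonneg _) (abs_nonneg _)) (Finset.mem_univ w)
  rw [Prod.norm_def]
  exact max_le (h1.trans (le_add_of_nonneg_right hS₂0)) (h2.trans (le_add_of_nonneg_left hS₁0))

end Directions

end Literature.NumberTheory.Automorphic
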